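import Mathlib
import Literature.Computability.AlgebraicComplexity.MignonRessayreBound
import Summits.ValiantsHypothesis.ValiantsHypothesis.Theorems.GrenetZeonTwoDimCoefficientsDefs
import Summits.ValiantsHypothesis.ValiantsHypothesis.Theorems.RefutationDegreeBeyondHessianNsStubBorderedDet

/-!
# Crux `GrenetZeon.TwoDimCoefficients` (stmt-ValiantsHypothesis-8062), line `dim2_cases`,
# stub `stub_dualUnipotent` — calibration of the isolated sub-case

The registered stub `stub_dualUnipotent : DualUnipotentBound` of the line `dim2_cases` asks for
`n² ≤ C·m` whenever `per_n = α·det A + β·tr(adj A · B)` with `A`, `B` affine `m × m` matrices over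
`ℂ[x_{ij}]` and `det A ≡ c ≠ 0` (the DUAL shape of a representation over `ℂ[ε]/ε²` in the one
sub-case where `det A` has no zero at all, so that no Hessian point is available).  This file
records what IS provable about that sub-case with the tree's tools, as helper lemmas attached to
the crux item (`--supports stmt-ValiantsHypothesis-8062`); it does not close the stub.

* `det_border`, `det_border_rankOne`: the bordered-determinant (Cauchy) identity
  `det [[s, rᵀ], [q, M]] = s·det M − rᵀ·adj M·q` (from the tree's
  `RefutationDegreeBeyondHessianNs.stub_borderedDet`) and its rank-one reading
  `α·det A + β·tr(adj A · u vᵀ) = det [[α, −β vᵀ], [u, A]]`.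
* `hasDetRepr_of_dualRepr_rankOne`, `sq_le_of_dualRepr_rankOne`: in the DUAL shape with a
  rank-one direction `B = u·vᵀ` (`u` affine, `v` constant) the permanent is an ordinary affine
  determinant of size `m + 1`, so Mignon–Ressayre gives `n² ≤ 2(m + 1)` — for EVERY `det A`,
  constant or not.  This is the single-(source, sink) case of the unipotent model (Valiant's
  branching-program-to-determinant conversion); the open content of the stub is the rank of `B`.
* `adjugate_diagCopies`, `det_transferMatrix`, `hasDetRepr_of_dualUnipotentRepr`: the honest
  transfer constant of the unipotent sub-case.  With `Â = diag(A, …, A)` (`m` copies, determinant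
  `c^m`, adjugate `c^{m−1}·diag(adj A, …, adj A)`), `tr(adj A · B) = vec(1)ᵀ · diag(adj A) · vec(B)`
  is ONE bordered determinant, so `per_n` has an affine determinantal representation of size
  `m² + 1` (against the generic `3(m + 1)³` of the route's `TransferToDc`), whence
  `n² ≤ 2(m² + 1)` and the linear bound `n ≤ 2m` (`sq_le_of_dualUnipotentRepr`,
  `dualUnipotentRepr_linearBound`).  The quadratic bound `n² ≤ C·m` of the stub is NOT reached:
  the size-`m` unipotent trace model contains `tr(X·Y)` for generic `w × w` matrices `X`, `Y` at
  `m = 2w` (take `A = [[1, −X], [0, 1]]`, `B = [[0, 0], [Y, 0]]`), a quadratic form of rank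
  `2w² = m²/2` in `m²/2` variables, so no pointwise Hessian-rank bound of Mignon–Ressayre type
  (`rank ≤ C·m`) holds in this model, and the `m² + 1` transfer is sharp up to the factor `4`
  (`dc(tr(X·Y)) ≥ w² = m²/4` by the Hessian at a point of the quadric).

* `dualUnipotentBound_of_quartic_dc`: the exchange rate — a quartic lower bound `n⁴ ≤ C·dc(per_n)`
  (open; even `ω(n²)` is open) would imply the stub through the `m² + 1` transfer.

HONEST FRAMING: these are constant-size bookkeeping lemmas in the quadratic regime; the stub
`DualUnipotentBound` stays open (it asserts a lower bound linear in the number of variables for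
the permanent in a trace-closed branching-program model, where the published tools give only the
square root); `VP ≠ VNP` is not moved by anything here.

References: T. Mignon, N. Ressayre, Int. Math. Res. Not. 2004:79, Thm. 1.1;
L. G. Valiant, Completeness classes in algebra, STOC 1979, §2 (branching programs as
determinants); J. M. Landsberg, *Geometry and Complexity Theory* (2017), §6.4, §7.3.
-/

-- single-conjunct layout `Summits/ValiantsHypothesis/ValiantsHypothesis`: the duplicated namespace
-- component is mandated by the tree.
set_option linter.dupNamespace false

noncomputable section

namespace Summit.ValiantsHypothesis.ValiantsHypothesis.Cruxes.TwoDimCoefficients.DimTwoCases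

open Literature.Computability.AlgebraicComplexity Matrix MvPolynomial

/-! ### The bordered determinant -/

section Border

variable {R : Type} {k : ℕ}

/-- The bordered matrix `[[s, rᵀ], [q, M]]` of size `k + 1`: corner `s`, first row `r`, first
column `q`, lower-right block `M`. [folklore] -/
def border (s : R) (r q : Fin k → R) (M : Matrix (Fin k) (Fin k) R) :
    Matrix (Fin (k + 1)) (Fin (k + 1)) R :=
  Matrix.of (Fin.cons (Fin.cons s r : Fin (k + 1) → R)
    (fun i => (Fin.cons (q i) (M i) : Fin (k + 1) → R)))

/-- Corner entry of the bordered matrix. [folklore] -/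
@[simp] theorem border_zero_zero (s : R) (r q : Fin k → R) (M : Matrix (Fin k) (Fin k) R) :
    border s r q M 0 0 = s := by
  simp [border]

/-- First-row entries of the bordered matrix. [folklore] -/
@[simp] theorem border_zero_succ (s : R) (r q : Fin k → R) (M : Matrix (Fin k) (Fin k) R)
    (j : Fin k) : border s r q M 0 j.succ = r j := by
  simp [border]

/-- First-column entries of the bordered matrix. [folklore] -/
@[simp] theorem border_succ_zero (s : R) (r q : Fin k → R) (M : Matrix (Fin k) (Fin k) R)
    (i : Fin k) : border s r q M i.succ 0 = q i := by
  simp [border]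

/-- Block entries of the bordered matrix. [folklore] -/
@[simp] theorem border_succ_succ (s : R) (r q : Fin k → R) (M : Matrix (Fin k) (Fin k) R)
    (i j : Fin k) : border s r q M i.succ j.succ = M i j := by
  simp [border]

/-- The lower-right block of the bordered matrix is `M`. [folklore] -/
theorem border_submatrix (s : R) (r q : Fin k → R) (M : Matrix (Fin k) (Fin k) R) :
    (border s r q M).submatrix Fin.succ Fin.succ = M := by
  ext i j
  simp

variable [CommRing R]

/-- **Cauchy's bordered-determinant formula** for `border`:
`det [[s, rᵀ], [q, M]] = s·det M − Σ_{i j} r_j (adj M)_{j i} q_i`. (Tree: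
`RefutationDegreeBeyondHessianNs.stub_borderedDet`.) [folklore] -/
theorem det_border (s : R) (r q : Fin k → R) (M : Matrix (Fin k) (Fin k) R) :
    (border s r q M).det = s * M.det - ∑ i, ∑ j, r j * M.adjugate j i * q i := by
  have h := Summit.ValiantsHypothesis.ValiantsHypothesis.Theorems.RefutationDegreeBeyondHessianNs.stub_borderedDet
    R k (border s r q M)
  simpa [border_submatrix] using h

/-- Rank-one reading of the bordered determinant:
`det [[a, −b vᵀ], [u, A]] = a·det A + b·tr(adj A · u vᵀ)`. [folklore] -/
theorem det_border_rankOne (a b : R) (A : Matrix (Fin k) (Fin k) R) (u v : Fin k → R) :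
    (border a (fun j => -(b * v j)) u A).det = a * A.det + b * (A.adjugate * vecMulVec u v).trace := by
  rw [det_border]
  have hs : ∑ i, ∑ j, -(b * v j) * A.adjugate j i * u i =
      -(b * (A.adjugate * vecMulVec u v).trace) := by
    simp only [Matrix.trace, Matrix.diag_apply, Matrix.mul_apply, vecMulVec_apply, Finset.mul_sum,
      ← Finset.sum_neg_distrib]
    rw [Finset.sum_comm]
    refine Finset.sum_congr rfl fun j _ => Finset.sum_congr rfl fun i _ => ?_
    ring
  rw [hs]
  ring

end Border

/-! ### The rank-one case of the dual shape is an ordinary determinant -/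

/-- **DUAL shape with a rank-one direction is determinantal of size `m + 1`.** If
`per_n = α·det A + β·tr(adj A · u vᵀ)` with `A` affine `m × m`, `u` an affine column and `v` a
constant row, then `per_n = det [[α, −β vᵀ], [u, A]]`, an affine determinant of size `m + 1`
(Valiant's single-(source, sink) branching-program-to-determinant conversion in matrix form; no
hypothesis on `det A`). [folklore] -/
theorem hasDetRepr_of_dualRepr_rankOne {n m : ℕ} (α β : ℂ) (A : AffMat n m)
    (u : Fin m → MvPolynomial (Fin n × Fin n) ℂ) (v : Fin m → ℂ)
    (hA : IsAffine A) (hu : ∀ i, (u i).totalDegree ≤ 1)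
    (h : perPoly (Fin n) ℂ = MvPolynomial.C α * A.det +
      MvPolynomial.C β * (A.adjugate * vecMulVec u (fun j => MvPolynomial.C (v j))).trace) :
    HasDetRepr (perPoly (Fin n) ℂ) (m + 1) := by
  refine ⟨border (C α) (fun j => -(C β * C (v j))) u A, fun i j => ?_, ?_⟩
  · rcases Fin.eq_zero_or_eq_succ i with rfl | ⟨i', rfl⟩ <;>
      rcases Fin.eq_zero_or_eq_succ j with rfl | ⟨j', rfl⟩
    · simp
    · simp only [border_zero_succ, totalDegree_neg, ← map_mul, totalDegree_C]
      exact Nat.zero_le _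
    · simpa using hu i'
    · simpa using hA i' j'
  · rw [det_border_rankOne, ← h]

/-- **Mignon–Ressayre in the rank-one dual case:** under the hypotheses of
`hasDetRepr_of_dualRepr_rankOne` and `n ≥ 3`, `n² ≤ 2(m + 1)`.  So `DualUnipotentBound` holds
with `C = 4` on the sub-family of unipotent representations whose direction `B` has rank one —
the open content of the stub is the rank of `B`. [cite: MignonRessayre2004, Thm. 1.1] -/
theorem sq_le_of_dualRepr_rankOne {n m : ℕ} (hn : 3 ≤ n) (α β : ℂ) (A : AffMat n m)
    (u : Fin m → MvPolynomial (Fin n × Fin n) ℂ) (v : Fin m → ℂ)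
    (hA : IsAffine A) (hu : ∀ i, (u i).totalDegree ≤ 1)
    (h : perPoly (Fin n) ℂ = MvPolynomial.C α * A.det +
      MvPolynomial.C β * (A.adjugate * vecMulVec u (fun j => MvPolynomial.C (v j))).trace) :
    n ^ 2 ≤ 2 * (m + 1) := by
  obtain ⟨k, rfl⟩ : ∃ k, n = k + 3 := ⟨n - 3, by omega⟩
  exact sq_le_two_mul_of_hasDetRepr_perPoly (hasDetRepr_of_dualRepr_rankOne α β A u v hA hu h)

/-! ### Diagonal copies of `A`: determinant and adjugate -/

section Diag

variable {R : Type} [CommRing R] {m : ℕ}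

/-- `m` diagonal copies of an `m × m` matrix `A`, indexed by `Fin m × Fin m` (second coordinate =
block index): `diag(A, …, A) = 1_m ⊗ A`. [folklore] -/
def diagCopies (A : Matrix (Fin m) (Fin m) R) : Matrix (Fin m × Fin m) (Fin m × Fin m) R :=
  blockDiagonal fun _ : Fin m => A

/-- Entries of `diagCopies A`. [folklore] -/
theorem diagCopies_apply (A : Matrix (Fin m) (Fin m) R) (p q : Fin m × Fin m) :
    diagCopies A p q = if p.2 = q.2 then A p.1 q.1 else 0 := by
  simp [diagCopies, blockDiagonal_apply]

/-- `det diag(A, …, A) = (det A)^m`. [folklore] -/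
theorem det_diagCopies (A : Matrix (Fin m) (Fin m) R) : (diagCopies A).det = A.det ^ m := by
  simp [diagCopies, Finset.prod_const, Finset.card_univ]

/-- `adj diag(A, …, A) = diag((det A)^{m−1}·adj A, …)` when `det A` is a unit and `m ≥ 1` (both
sides are the unique solution `X` of `diag(A,…,A)·X = (det A)^m·1`). [folklore] -/
theorem adjugate_diagCopies (A : Matrix (Fin m) (Fin m) R) (hA : IsUnit A.det) (hm : 1 ≤ m) :
    (diagCopies A).adjugate = blockDiagonal fun _ : Fin m => A.det ^ (m - 1) • A.adjugate := by
  have hD : IsUnit (diagCopies A).det := by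
    rw [det_diagCopies]
    exact hA.pow m
  have key : diagCopies A * blockDiagonal (fun _ : Fin m => A.det ^ (m - 1) • A.adjugate) =
      diagCopies A * (diagCopies A).adjugate := by
    rw [mul_adjugate, det_diagCopies, diagCopies, ← blockDiagonal_mul]
    have h1 : (fun _ : Fin m => A * (A.det ^ (m - 1) • A.adjugate)) =
        A.det ^ m • (1 : Fin m → Matrix (Fin m) (Fin m) R) := by
      funext i
      rw [Matrix.mul_smul, mul_adjugate, smul_smul, ← pow_succ, Nat.sub_add_cancel hm]
      rfl
    rw [h1, blockDiagonal_smul, blockDiagonal_one]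
  calc (diagCopies A).adjugate
      = (diagCopies A)⁻¹ * (diagCopies A * (diagCopies A).adjugate) :=
        (Matrix.nonsing_inv_mul_cancel_left (diagCopies A) _ hD).symm
    _ = (diagCopies A)⁻¹ *
          (diagCopies A * blockDiagonal fun _ : Fin m => A.det ^ (m - 1) • A.adjugate) := by
        rw [key]
    _ = blockDiagonal fun _ : Fin m => A.det ^ (m - 1) • A.adjugate :=
        Matrix.nonsing_inv_mul_cancel_left (diagCopies A) _ hD

/-- The reindexing `Fin (m·m) ≃ Fin m × Fin m`. [folklore] -/
def eProd (m : ℕ) : Fin (m * m) ≃ Fin m × Fin m := finProdFinEquiv.symm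

/-- `diag(A, …, A)` reindexed by `Fin (m·m)`. [folklore] -/
def bigBlock (A : Matrix (Fin m) (Fin m) R) : Matrix (Fin (m * m)) (Fin (m * m)) R :=
  (diagCopies A).submatrix (eProd m) (eProd m)

/-- `det` of the reindexed block matrix. [folklore] -/
theorem det_bigBlock (A : Matrix (Fin m) (Fin m) R) : (bigBlock A).det = A.det ^ m := by
  rw [bigBlock, det_submatrix_equiv_self, det_diagCopies]

/-- The row border `vec(g·1_m)`: `g` at the positions `(k, k)`, `0` elsewhere. [folklore] -/
def diagRow (m : ℕ) (g : R) : Fin (m * m) → R :=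
  fun j => if (eProd m j).1 = (eProd m j).2 then g else 0

/-- The column border `vec(B)`. [folklore] -/
def vecCol (B : Matrix (Fin m) (Fin m) R) : Fin (m * m) → R :=
  fun i => B (eProd m i).1 (eProd m i).2

/-- The border sum of Cauchy's formula for `[[s, vec(g·1)ᵀ], [vec B, diag(A,…,A)]]` is
`g·(det A)^{m−1}·tr(adj A · B)`. [folklore] -/
theorem border_sum_eq_trace (A B : Matrix (Fin m) (Fin m) R) (g : R) (hA : IsUnit A.det)
    (hm : 1 ≤ m) :
    ∑ i, ∑ j, diagRow m g j * (bigBlock A).adjugate j i * vecCol B i =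
      g * A.det ^ (m - 1) * (A.adjugate * B).trace := by
  rw [bigBlock, adjugate_submatrix_equiv_self, adjugate_diagCopies A hA hm]
  have step : ∑ i, ∑ j, diagRow m g j *
        (blockDiagonal fun _ : Fin m => A.det ^ (m - 1) • A.adjugate).submatrix (eProd m) (eProd m)
          j i * vecCol B i =
      ∑ p : Fin m × Fin m, ∑ q : Fin m × Fin m, (if q.1 = q.2 then g else 0) *
        (blockDiagonal (fun _ : Fin m => A.det ^ (m - 1) • A.adjugate) q p) * B p.1 p.2 := by
    refine Fintype.sum_equiv (eProd m) _ _ fun i => ?_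
    refine Fintype.sum_equiv (eProd m) _ _ fun j => ?_
    simp [diagRow, vecCol]
  rw [step]
  simp only [blockDiagonal_apply, Matrix.smul_apply, smul_eq_mul, Fintype.sum_prod_type, ite_mul,
    zero_mul, mul_ite, mul_zero]
  simp only [Finset.sum_ite_eq', Finset.mem_univ, if_true]
  simp only [Matrix.trace, Matrix.diag_apply, Matrix.mul_apply, Finset.mul_sum]
  rw [Finset.sum_comm]
  refine Finset.sum_congr rfl fun b _ => Finset.sum_congr rfl fun a _ => ?_
  ring

end Diag

/-! ### The transfer: `per_n` is one affine determinant of size `m² + 1` -/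

/-- The transfer matrix `[[α c^{1−m}, −β c^{1−m}·vec(1)ᵀ], [vec B, diag(A, …, A)]]` of size
`m² + 1`. [folklore] -/
def transferMatrix {n m : ℕ} (α β c : ℂ) (A B : AffMat n m) :
    Matrix (Fin (m * m + 1)) (Fin (m * m + 1)) (MvPolynomial (Fin n × Fin n) ℂ) :=
  border (C (α * c * (c ^ m)⁻¹)) (diagRow m (C (-(β * (c ^ (m - 1))⁻¹)))) (vecCol B) (bigBlock A)

/-- `det` of the transfer matrix is `α·det A + β·tr(adj A · B)` when `det A = c ≠ 0` is constant.
[folklore] -/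
theorem det_transferMatrix {n m : ℕ} (hm : 1 ≤ m) (α β c : ℂ) (hc : c ≠ 0) (A B : AffMat n m)
    (hA : A.det = MvPolynomial.C c) :
    (transferMatrix α β c A B).det =
      MvPolynomial.C α * A.det + MvPolynomial.C β * (A.adjugate * B).trace := by
  have hu : IsUnit A.det := by
    rw [hA]
    exact (isUnit_iff_ne_zero.mpr hc).map MvPolynomial.C
  rw [transferMatrix, det_border, border_sum_eq_trace A B _ hu hm, det_bigBlock, hA]
  have h1 : C (α * c * (c ^ m)⁻¹) * (C c : MvPolynomial (Fin n × Fin n) ℂ) ^ m = C α * C c := by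
    rw [← map_pow, ← map_mul, ← map_mul]
    congr 1
    field_simp
  have h2 : C (-(β * (c ^ (m - 1))⁻¹)) * (C c : MvPolynomial (Fin n × Fin n) ℂ) ^ (m - 1) = -C β := by
    rw [← map_pow, ← map_mul, ← map_neg]
    congr 1
    field_simp
  rw [h1, h2]
  ring

/-- Entries of the transfer matrix are affine when `A` and `B` are. [folklore] -/
theorem isAffine_transferMatrix {n m : ℕ} (α β c : ℂ) (A B : AffMat n m) (hA : IsAffine A)
    (hB : IsAffine B) : ∀ i j, (transferMatrix α β c A B i j).totalDegree ≤ 1 := by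
  intro i j
  rcases Fin.eq_zero_or_eq_succ i with rfl | ⟨i', rfl⟩ <;>
    rcases Fin.eq_zero_or_eq_succ j with rfl | ⟨j', rfl⟩
  · rw [transferMatrix, border_zero_zero, totalDegree_C]
    exact Nat.zero_le _
  · simp only [transferMatrix, border_zero_succ, diagRow]
    split_ifs
    · rw [totalDegree_C]
      exact Nat.zero_le _
    · rw [totalDegree_zero]
      exact Nat.zero_le _
  · simpa [transferMatrix, vecCol] using hB _ _
  · simp only [transferMatrix, border_succ_succ, bigBlock, submatrix_apply, diagCopies_apply]
    split_ifs
    · exact hA _ _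
    · simp

/-- A `0 × 0` representation is impossible for `n ≥ 1`: it would make `per_n` constant.
[folklore] -/
theorem not_dualUnipotentRepr_zero {n : ℕ} (hn : 1 ≤ n) : ¬ DualUnipotentRepr n 0 := by
  rintro ⟨α, β, c, A, B, -, -, -, -, hper⟩
  have h0 : perPoly (Fin n) ℂ = C α := by
    simpa [Matrix.det_isEmpty, Matrix.trace] using hper
  haveI : Nonempty (Fin n) := ⟨⟨0, hn⟩⟩
  have e0 := congrArg (MvPolynomial.eval fun _ : Fin n × Fin n => (0 : ℂ)) h0
  have e1 := congrArg (MvPolynomial.eval fun p : Fin n × Fin n => if p.1 = p.2 then (1 : ℂ) else 0) h0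
  rw [eval_perPoly, eval_C] at e0 e1
  have hz : (Matrix.of fun _ _ : Fin n => (0 : ℂ)) = 0 := by
    ext i j
    rfl
  have ho : (Matrix.of fun i j : Fin n => if i = j then (1 : ℂ) else 0) = 1 := by
    ext i j
    simp [Matrix.one_apply]
  rw [hz, Matrix.permanent_zero] at e0
  rw [ho, Matrix.permanent_one] at e1
  exact zero_ne_one (e0.trans e1.symm)

/-- **Transfer of the unipotent sub-case to ordinary `dc`:** a `DualUnipotentRepr n m`
(`per_n = α·det A + β·tr(adj A · B)`, `det A ≡ c ≠ 0`, `A`, `B` affine `m × m`) yields an affine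
determinantal representation of `per_n` of size `m² + 1` (`n ≥ 1`). [folklore] -/
theorem hasDetRepr_of_dualUnipotentRepr {n m : ℕ} (hn : 1 ≤ n) (h : DualUnipotentRepr n m) :
    HasDetRepr (perPoly (Fin n) ℂ) (m * m + 1) := by
  rcases Nat.eq_zero_or_pos m with rfl | hm
  · exact absurd h (not_dualUnipotentRepr_zero hn)
  obtain ⟨α, β, c, A, B, hA, hB, hc, hdet, hper⟩ := h
  exact ⟨transferMatrix α β c A B, isAffine_transferMatrix α β c A B hA hB,
    by rw [det_transferMatrix hm α β c hc A B hdet, hper]⟩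

/-- **Mignon–Ressayre after the transfer:** `DualUnipotentRepr n m` with `n ≥ 3` forces
`n² ≤ 2(m² + 1)`. [cite: MignonRessayre2004, Thm. 1.1] -/
theorem sq_le_of_dualUnipotentRepr {n m : ℕ} (hn : 3 ≤ n) (h : DualUnipotentRepr n m) :
    n ^ 2 ≤ 2 * (m * m + 1) := by
  obtain ⟨k, rfl⟩ : ∃ k, n = k + 3 := ⟨n - 3, by omega⟩
  exact sq_le_two_mul_of_hasDetRepr_perPoly (hasDetRepr_of_dualUnipotentRepr (by omega) h)

/-- **The linear bound (calibration of `DualUnipotentBound`):** `DualUnipotentRepr n m` with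
`n ≥ 3` forces `n ≤ 2m`.  The registered stub asks for the quadratically stronger `n² ≤ C·m`,
which this file does not prove. [folklore] -/
theorem dualUnipotentRepr_linearBound :
    ∃ C n₀ : ℕ, ∀ n ≥ n₀, ∀ m : ℕ, DualUnipotentRepr n m → n ≤ C * m := by
  refine ⟨2, 3, fun n hn m h => ?_⟩
  have h1 := sq_le_of_dualUnipotentRepr hn h
  have hm : 1 ≤ m := by
    rcases Nat.eq_zero_or_pos m with rfl | hm
    · exact absurd h (not_dualUnipotentRepr_zero (by omega))
    · exact hm
  have h2 : n ^ 2 ≤ (2 * m) ^ 2 := by nlinarith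
  exact (Nat.pow_le_pow_iff_left (by norm_num)).mp h2

/-- **What classical strength would close the stub:** a QUARTIC lower bound for the
determinantal complexity of the permanent (`n⁴ ≤ C·M` whenever `per_n = det` of an affine
`M × M` matrix, `n` large) implies `DualUnipotentBound`, through the `m² + 1` transfer
`hasDetRepr_of_dualUnipotentRepr`.  The hypothesis is far beyond Mignon–Ressayre's `n² ≤ 2M`
(already an `ω(n²)` bound for `dc(per_n)` is open, Landsberg 2017, Rem. 7.3.2.4); the theorem
only records the exchange rate, it is not evidence for the stub. [folklore] -/
theorem dualUnipotentBound_of_quartic_dc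
    (h : ∃ C n₀ : ℕ, ∀ n ≥ n₀, ∀ M : ℕ, HasDetRepr (perPoly (Fin n) ℂ) M → n ^ 4 ≤ C * M) :
    DualUnipotentBound := by
  obtain ⟨C, n₀, hC⟩ := h
  refine ⟨2 * C, max n₀ 1, fun n hn m hrep => ?_⟩
  have hn₀ : n₀ ≤ n := le_trans (le_max_left _ _) hn
  have hn1 : 1 ≤ n := le_trans (le_max_right _ _) hn
  have hm : 1 ≤ m := by
    rcases Nat.eq_zero_or_pos m with rfl | hm
    · exact absurd hrep (not_dualUnipotentRepr_zero hn1)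
    · exact hm
  have h4 : n ^ 4 ≤ C * (m * m + 1) := hC n hn₀ _ (hasDetRepr_of_dualUnipotentRepr hn1 hrep)
  -- `n⁴ ≤ C (m² + 1) ≤ (C (m + 1))²`, hence `n² ≤ C (m + 1) ≤ 2 C m`.
  have h5 : (n ^ 2) ^ 2 ≤ (C * (m + 1)) ^ 2 := by
    have hC1 : C * (m * m + 1) ≤ (C * (m + 1)) ^ 2 := by
      have hCC : C ≤ C * C := Nat.le_mul_self C
      have hmm : m * m + 1 ≤ (m + 1) * (m + 1) := by nlinarith
      calc C * (m * m + 1) ≤ (C * C) * (m * m + 1) := Nat.mul_le_mul_right _ hCC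
        _ ≤ (C * C) * ((m + 1) * (m + 1)) := Nat.mul_le_mul_left _ hmm
        _ = (C * (m + 1)) ^ 2 := by ring
    calc (n ^ 2) ^ 2 = n ^ 4 := by ring
      _ ≤ C * (m * m + 1) := h4
      _ ≤ (C * (m + 1)) ^ 2 := hC1
  have h6 : n ^ 2 ≤ C * (m + 1) := (Nat.pow_le_pow_iff_left (by norm_num)).mp h5
  calc n ^ 2 ≤ C * (m + 1) := h6
    _ ≤ 2 * C * m := by nlinarith

end Summit.ValiantsHypothesis.ValiantsHypothesis.Cruxes.TwoDimCoefficients.DimTwoCases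

end
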